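import Summits.QuantumFields.YangMills.Theorems.BalabanUVNodesN15PerCubeGreenLandauLetterClose
import Summits.QuantumFields.YangMills.Theorems.BalabanUVNodesN15PerCubeGreenLandauCutBoxGeometry
import HarnessLib

/-!
# N15 = NE2, road (c) — PROGRAMME (PC), (PC-D) «the per-cube LANDAU LETTER», VIII: THE PER-CUBE PACKAGE WITH THE MARGIN ON THE WHOLE INPUT-CUT BOX — n15-c∕311's package run with
# n15-c∕312's far zone: `d_Z ≥ L^m` on every block of `c(2w,k)+[0,6w+1)^{d+1}` (the support of the knit's input cut `χ_k`), the per-cube (3.35) datum asked on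
# `c(Lw+6w−m₀, k) + [0, Lw+16w+2)^{d+1}` (`L ≥ 17`) (dag-n15-c g29, n15-c∕313)

Cell `pub-ymgap`, seat `pub-ymgap-dag-n15-c` (generation g29; R134 (a), s1; HUMAN RULING D-0062).  `bears_on: R4∕N15 · K3⁸ SpineGivenEndpointR13SepCoPHV (stmt-QuantumFields-27366)`;
filed `--kind proof --supports stmt-QuantumFields-27366 --as helper` — COUNT-NEUTRAL.  One theorem, 0 `def`, 0 `sorry`; the proof is n15-c∕311's VERBATIM with `exists_farZone₃` for
`exists_farZone₂` and the larger locality box (n15-c∕299e's box restricted from it by `mem_cubeBlocks_of_mem_inner`).  Imports BY NAME n15-c∕311 (through it 310, 299e, 299h, 198, 264)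
and n15-c∕312.  Nothing in the tree is modified.

WHY ((PC-D)).  52's knit reads the per-cube perturbation behind the input cut `χ_k` (box `c(2w,k)+[0,6w+1)`, n15-c∕260 `scChi` ∕ n15-c∕181 `cvChi`): with `d_Z ≥ w = L^m` there and
`d_Z` Lipschitz, BOTH weights of the letter are small behind the cut — `e^{−δd_Z(z′)} ≤ e^{−δw}` at the input and `e^{−δd_Z(z)}e^{−δ|z−z′|} ≤ e^{−δw∕2}e^{−(δ∕2)|z−z′|}` at the output —
which is the `hNVcut`∕`hfarN` currency of the knit for the (nonlocal) Landau summand.  n15-c∕311 (margin on `supp h_k` only, `L ≥ 11`) stays the lighter edition.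

HONEST FRAMING ∕ LIMITS.  MODEL carriers (the cover of n15-c∕260 on the doubled unit torus; cube regions = half the torus, so the locality box `(L+16)w+2` is most of the torus `2Lw` —
the model's artefact, a box nonetheless); composition of LANDED theorems; [B9] (3.49) p.399, Thm 3.4 p.400, Cor. 3.8 p.410, (3.95)–(3.96) p.411, (3.33)–(3.35) p.396 cited for SHAPES ∕
MECHANISM, NOT the printed statements.  NE2⁺ NOT PRINTED, NOT proved; N15 of record untouched (DISCHARGED AS CONSUMED, p687738); K3⁸ OPEN; counts of record UNMOVED; one finite 𝕋⁴ at
fixed ε per index — NOT infinite volume, NOT OS on ℝ⁴, NOT a mass gap, NOT Clay.  Restate-immune (no Theses import).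
-/

noncomputable section

open scoped BigOperators Matrix Matrix.Norms.L2Operator

namespace Summit.QuantumFields.YangMills.BalabanUVNodes.N15.Gluing

open Real
open Literature.MathematicalPhysics.QuantumFieldTheory.Balaban1983to89
open Literature.MathematicalPhysics.QuantumFieldTheory.Balaban1983to89.B5Prop11Plancherel (Tor fine unitVec)
open Literature.MathematicalPhysics.QuantumFieldTheory.Balaban1983to89.B5Block118 (up bpt)
open Literature.MathematicalPhysics.QuantumFieldTheory.Balaban1983to89.B11SectG (BlockNorm HasMaj RowSum)
open Literature.MathematicalPhysics.QuantumFieldTheory.Balaban1983to89.B6RandomWalk (Triangle254)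
open Literature.MathematicalPhysics.QuantumFieldTheory.Balaban1983to89.B6UnitTorusCarrier (unitTorusGeo triangle254_unitTorusGeo rowSum_unitTorusGeo unitTorusGeo_dist_nonneg unitTorusGeo_dist_self)
open Literature.MathematicalPhysics.QuantumFieldTheory.Balaban1983to89.B9Eq335RegularityClasses (Reg335Cube)
open Literature.MathematicalPhysics.QuantumFieldTheory.Balaban1983to89.B9Eq336RegularityClassesOrbit (reg335Cube_gaugeTr)
open Literature.MathematicalPhysics.QuantumFieldTheory.Balaban1983to89.B9Eq3117Current (gaugeTr gaugeTr_one)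
open Literature.MathematicalPhysics.QuantumFieldTheory.Balaban1983to89.B9Eq39Adjoint (covD fluct)
open Summit.QuantumFields.YangMills.BalabanUVNodes.N15.CovLandau (cSop cSop_gauge landauCov landauCov_gauge bdiag bdiag_transpose bdiag_mul_bdiag bdiag_one bdiag_orth bdiag_orth' isUnit_cSop mulVecLin_sub')
open Summit.QuantumFields.YangMills.BalabanUVNodes.N15.BackgroundModel (kappa_ofBlocks)
open Literature.MathematicalPhysics.QuantumFieldTheory.King1986 (aK aK_pos aK_le aK_ge)
open Literature.MathematicalPhysics.QuantumFieldTheory.King1986.Torus (blockOf)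
open Literature.Barriers.QuantumFields (traceForm)
open Summit.QuantumFields.YangMills.BalabanUVNodes.N15.MatrixSpecies (mmulOp coordMat basisConst liftBlk mmulOp_comp_mmulOp)
open Summit.QuantumFields.YangMills.BalabanUVNodes.N15.TwoGrid (cubeBlocks)
open Summit.QuantumFields.YangMills.BalabanUVNodes.N15.CurvedSpecies (uN_val_gaugeTr_eq uN_val_inv_eq_conjTranspose uN_coordMat_conj_orthogonal hasMaj_gaugeConj mmulOp_one)

variable {d : ℕ}

/-! ## The per-cube package with the margin on the input-cut box -/

section PerCube

variable {L : ℕ} [NeZero L]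

set_option maxHeartbeats 800000 in
/-- ★★★ **THE PER-CUBE LANDAU LETTER, MARGIN ON THE WHOLE INPUT-CUT BOX.**  n15-c∕311 `exists_landauCov_gaugeTr_sub_flat` with n15-c∕312's far zone: for `(d, L ≥ 17, a₀, ι)` there are
`δ, w₀, R₀, B > 0` such that at every `(m, k)` (`k ≥ 1`, `L^m ≥ w₀`), for a unitary `U`, (3.35) letters `ξ, C`, a family of unitary cube gauges `w_k` with (3.35) potentials for `U^{w_k}` on the
boxes `c(Lw+6w−m₀, k) + [0, Lw+16w+2)^{d+1}`, smallness letters `r_V` (three displayed bounds), `Σ₀(r_V) ≤ R₀`, `σ(r_V) ≤ R₀`: for every cube `k` there is `d_Z ≥ 0`, Lipschitz, with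
`d_Z(y) ≥ L^m` for EVERY block `y` of the input-cut box `c(2w,k)+[0,6w+1)^{d+1}` (the support of the knit's `χ_k`), and
`mulVecLin (landauCov (cvT e U^{w_k}) a_K) − mulVecLin (landauCov 𝟙 a_K) ≤ B·(r_V(1+|J⊕J|) + a_K|ι|(|ι|σ²+2σ) + σ + (L^m)⁻¹ + e^{−δd_Z(z)} + e^{−δd_Z(z′)})·e^{−δ|z−z′|_T}` on the coloured bond
carrier — so that behind the input cut both weights are `≤ e^{−δL^m∕2}`-small (Lipschitz).  MODEL carriers; the SHAPE of [B9] (3.49) ∕ Thm 3.4 localised per cube as in Cor. 3.8.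
[cite: Balaban1985BackgroundPropagators, (3.49) p.399, Thm 3.4 p.400, Cor. 3.8 p.410, (3.95)–(3.96) p.411, (3.33)–(3.35) p.396 (shapes ∕ mechanism); Balaban1984PropagatorsI, (1.20) p.20] -/
theorem exists_landauCov_gaugeTr_sub_flat_cutBox (hL : Odd L ∧ 1 < L) (hL17 : 17 ≤ L) {a₀ : ℝ} (ha₀ : 0 < a₀) (ι : Type) [Fintype ι] [DecidableEq ι] :
    ∃ δ w₀ R₀ B : ℝ, 0 < δ ∧ 0 < R₀ ∧ 0 < B ∧
      ∀ (mv kk : ℕ), 1 ≤ kk → w₀ ≤ ((L ^ mv : ℕ) : ℝ) →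
      ∀ {mm : Type} [Fintype mm] [DecidableEq mm] [Nonempty mm] (e : Matrix mm mm ℂ ≃L[ℝ] (ι → ℝ)), (∀ A B : Matrix mm mm ℂ, traceForm A B = e A ⬝ᵥ e B) →
      ∀ (U : Fin (d + 1) → ScX d L mv kk hL → (Matrix mm mm ℂ)ˣ), (∀ μ x, (U μ x : Matrix mm mm ℂ) ∈ Matrix.unitaryGroup mm ℂ) →
      ∀ (ξ C : ℝ), 0 < ξ → 0 < C →
      ∀ (w : (Fin (d + 1) → ZMod (2 * L)) → ScX d L mv kk hL → (Matrix mm mm ℂ)ˣ), (∀ k x, (w k x : Matrix mm mm ℂ) ∈ Matrix.unitaryGroup mm ℂ) →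
        (∀ k : Fin (d + 1) → ZMod (2 * L), ∃ A : Fin (d + 1) → ScX d L mv kk hL → Matrix mm mm ℂ,
          (∀ μ, ∀ z ∈ {x : ScX d L mv kk hL | blockOf (L ^ kk) (cvM d L mv kk hL) x ∈ cubeBlocks (cvM d L mv kk hL) (coverCorner (cvM d L mv kk hL) (L ^ mv) L (L * L ^ mv + 6 * L ^ mv - coverMargin L mv) k) (L * L ^ mv + 16 * L ^ mv + 2)}, gaugeTr (scShift d L mv kk hL) (w k) U μ z = fluct (((((L ^ kk : ℕ) : ℝ))⁻¹)) A μ z) ∧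
          (∀ μ, ∀ z ∈ {x : ScX d L mv kk hL | blockOf (L ^ kk) (cvM d L mv kk hL) x ∈ cubeBlocks (cvM d L mv kk hL) (coverCorner (cvM d L mv kk hL) (L ^ mv) L (L * L ^ mv + 6 * L ^ mv - coverMargin L mv) k) (L * L ^ mv + 16 * L ^ mv + 2)}, ‖A μ z‖ < C * ξ⁻¹) ∧
          (∀ μ ν, ∀ z ∈ {x : ScX d L mv kk hL | blockOf (L ^ kk) (cvM d L mv kk hL) x ∈ cubeBlocks (cvM d L mv kk hL) (coverCorner (cvM d L mv kk hL) (L ^ mv) L (L * L ^ mv + 6 * L ^ mv - coverMargin L mv) k) (L * L ^ mv + 16 * L ^ mv + 2)}, ‖((↑(((((L ^ kk : ℕ) : ℝ))⁻¹)) : ℂ)⁻¹) • covD (scShift d L mv kk hL) (fun _ _ => (1 : (Matrix mm mm ℂ)ˣ)) μ (A ν) z‖ < C * (ξ ^ 2)⁻¹)) →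
      ∀ (rV : ℝ), 0 ≤ rV →
        Fintype.card ι * (@basisConst ι _ (Matrix mm mm ℂ) Matrix.frobeniusNormedAddCommGroup Matrix.frobeniusNormedSpace e * (2 * Real.sqrt (Fintype.card mm)) * (Real.sqrt (Fintype.card mm) * ((C / ξ) * Real.exp (((((L ^ kk : ℕ) : ℝ))⁻¹) * (C / ξ))))) ≤ rV →
        Fintype.card ι * (Fintype.card (Fin (d + 1)) * (Fintype.card ι * (@basisConst ι _ (Matrix mm mm ℂ) Matrix.frobeniusNormedAddCommGroup Matrix.frobeniusNormedSpace e * (2 * Real.sqrt (Fintype.card mm)) * (Real.sqrt (Fintype.card mm) * ((C / ξ) * Real.exp (((((L ^ kk : ℕ) : ℝ))⁻¹) * (C / ξ))))) ^ 2 + @basisConst ι _ (Matrix mm mm ℂ) Matrix.frobeniusNormedAddCommGroup Matrix.frobeniusNormedSpace e * (2 * Real.sqrt (Fintype.card mm)) * (Real.sqrt (Fintype.card mm) * ((C / ξ ^ 2) * Real.exp (((((L ^ kk : ℕ) : ℝ))⁻¹) * (C / ξ)))))) ≤ rV →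
        rV * (1 + Fintype.card (Fin (d + 1) ⊕ Fin (d + 1))) + a₀ * (Fintype.card ι * (Fintype.card ι * ((1 + rV * ((((L ^ kk : ℕ) : ℝ))⁻¹)) ^ ((d + 1) * L ^ kk) - 1) ^ 2 + 2 * ((1 + rV * ((((L ^ kk : ℕ) : ℝ))⁻¹)) ^ ((d + 1) * L ^ kk) - 1))) ≤ R₀ →
        ((1 + rV * ((((L ^ kk : ℕ) : ℝ))⁻¹)) ^ ((d + 1) * L ^ kk) - 1) ≤ R₀ →
      ∀ k : Fin (d + 1) → ZMod (2 * L), ∃ dZ : Tor (cvM d L mv kk hL) → ℝ,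
        (∀ y, 0 ≤ dZ y) ∧ (∀ y z, dZ y ≤ (unitTorusGeo L kk (cvM d L mv kk hL)).dist y z + dZ z) ∧
        (∀ y : Tor (cvM d L mv kk hL), y ∈ cubeBlocks (cvM d L mv kk hL) (coverCorner (cvM d L mv kk hL) (L ^ mv) L (2 * L ^ mv) k) (6 * L ^ mv + 1) → ((L ^ mv : ℕ) : ℝ) ≤ dZ y) ∧
        HasMaj (BlockNorm.ofBlocks (unitTorusGeo L kk (cvM d L mv kk hL)) (liftBlk (fun b : ScX d L mv kk hL × Fin (d + 1) => blockOf (L ^ kk) (cvM d L mv kk hL) b.1) ι)) (BlockNorm.ofBlocks (unitTorusGeo L kk (cvM d L mv kk hL)) (liftBlk (fun b : ScX d L mv kk hL × Fin (d + 1) => blockOf (L ^ kk) (cvM d L mv kk hL) b.1) ι))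
          (Matrix.mulVecLin (landauCov (cvM d L mv kk hL) (L ^ kk) (cvT e (fun μ x => (gaugeTr (scShift d L mv kk hL) (w k) U μ x : Matrix mm mm ℂ))) (aK a₀ (L : ℝ) kk * (((L ^ kk : ℕ) : ℝ)) ^ (d + 1))) - Matrix.mulVecLin (landauCov (cvM d L mv kk hL) (L ^ kk) (fun (_ : Fin (d + 1)) (_ : ScX d L mv kk hL) => (1 : Matrix ι ι ℝ)) (aK a₀ (L : ℝ) kk * (((L ^ kk : ℕ) : ℝ)) ^ (d + 1))))
          (fun z z' => B * (rV * (1 + Fintype.card (Fin (d + 1) ⊕ Fin (d + 1))) + aK a₀ (L : ℝ) kk * (Fintype.card ι * (Fintype.card ι * ((1 + rV * ((((L ^ kk : ℕ) : ℝ))⁻¹)) ^ ((d + 1) * L ^ kk) - 1) ^ 2 + 2 * ((1 + rV * ((((L ^ kk : ℕ) : ℝ))⁻¹)) ^ ((d + 1) * L ^ kk) - 1))) + ((1 + rV * ((((L ^ kk : ℕ) : ℝ))⁻¹)) ^ ((d + 1) * L ^ kk) - 1) + (((L ^ mv : ℕ) : ℝ))⁻¹ + Real.exp (-(δ * dZ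 z)) + Real.exp (-(δ * dZ z'))) * Real.exp (-(δ * (unitTorusGeo L kk (cvM d L mv kk hL)).dist z z'))) := by
  classical
  have hL7 : 7 ≤ L := by omega
  have hL11 : 11 ≤ L := by omega
  have hL1r : (1 : ℝ) < (L : ℝ) := by exact_mod_cast hL.2
  obtain ⟨δI, wI, RI, BI, hδI, hRI, hBI, HI⟩ := hasMaj_cSop_inv_of_reg335BigBox (d := d) hL hL11 ha₀ ι
  obtain ⟨δ₀, w₀, R₀, B₀, hδ₀, hR₀, hB₀, H₀⟩ := hasMaj_landauCov_sub_of_reg335 (d := d) hL hL7 ha₀ ι (BI := (Fintype.card ι : ℝ) ^ 2 * BI) (δI := δI) (by positivity) hδI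
  refine ⟨δ₀, max (max w₀ wI) 2, min R₀ RI, B₀, hδ₀, lt_min hR₀ hRI, hB₀, fun mv kk hk hw => ?_⟩
  intro mm _ _ _ e he U hU ξ C hξ hC w hwU hdat rV hrV hrA hrC hRle hσV k
  have hw₀ : w₀ ≤ ((L ^ mv : ℕ) : ℝ) := ((le_max_left _ _).trans (le_max_left _ _)).trans hw
  have hwI : wI ≤ ((L ^ mv : ℕ) : ℝ) := ((le_max_right _ _).trans (le_max_left _ _)).trans hw
  have hW2 : 2 ≤ L ^ mv := by have h := (le_max_right (max w₀ wI) 2).trans hw; exact_mod_cast h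
  have hRle₀ := hRle.trans (min_le_left R₀ RI)
  have hRleI := hRle.trans (min_le_right R₀ RI)
  have hσVI := hσV.trans (min_le_right R₀ RI)
  have hnpos : (0 : ℝ) < (((L ^ kk : ℕ) : ℝ)) ^ (d + 1) := by positivity
  have ha' : 0 < (aK a₀ (L : ℝ) kk * (((L ^ kk : ℕ) : ℝ)) ^ (d + 1)) := mul_pos (aK_pos ha₀ hL1r hk) hnpos
  have hU' : ∀ μ x, ((U μ x : Matrix mm mm ℂ))ᴴ * (U μ x : Matrix mm mm ℂ) = 1 := fun μ x => Matrix.mem_unitaryGroup_iff'.mp (hU μ x)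
  -- geometry: 299e's locality boxes inside the present ones
  have hM : ∀ ν, cvM d L mv kk hL ν = 2 * L * L ^ mv := MP_succ_eq L mv kk hL
  have hSB : L * L ^ mv + 16 * L ^ mv + 2 ≤ 2 * L * L ^ mv := by
    have h17 : 17 * L ^ mv ≤ L * L ^ mv := Nat.mul_le_mul_right _ hL17
    have e2 : 2 * L * L ^ mv = 2 * (L * L ^ mv) := by ring
    rw [e2]; omega
  have hsubB : ∀ (k' : Fin (d + 1) → ZMod (2 * L)) (x : ScX d L mv kk hL),
      blockOf (L ^ kk) (cvM d L mv kk hL) x ∈ cubeBlocks (cvM d L mv kk hL) (coverCorner (cvM d L mv kk hL) (L ^ mv) L (L * L ^ mv + 3 * L ^ mv - 1 - coverMargin L mv) k') (L * L ^ mv + 10 * L ^ mv) →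
      blockOf (L ^ kk) (cvM d L mv kk hL) x ∈ cubeBlocks (cvM d L mv kk hL) (coverCorner (cvM d L mv kk hL) (L ^ mv) L (L * L ^ mv + 6 * L ^ mv - coverMargin L mv) k') (L * L ^ mv + 16 * L ^ mv + 2) :=
    fun k' x hx => mem_cubeBlocks_of_mem_inner (m₀ := L * L ^ mv + 6 * L ^ mv - coverMargin L mv) (S₀ := L * L ^ mv + 16 * L ^ mv + 2) hM (by omega) (by omega) hSB hx
  have hbig : ∀ k' : Fin (d + 1) → ZMod (2 * L), ∃ (u : ScX d L mv kk hL → (Matrix mm mm ℂ)ˣ) (A : Fin (d + 1) → ScX d L mv kk hL → Matrix mm mm ℂ),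
      (∀ x, (u x : Matrix mm mm ℂ) ∈ Matrix.unitaryGroup mm ℂ) ∧
      (∀ μ, ∀ z ∈ {x : ScX d L mv kk hL | blockOf (L ^ kk) (cvM d L mv kk hL) x ∈ cubeBlocks (cvM d L mv kk hL) (coverCorner (cvM d L mv kk hL) (L ^ mv) L (L * L ^ mv + 3 * L ^ mv - 1 - coverMargin L mv) k') (L * L ^ mv + 10 * L ^ mv)}, gaugeTr (scShift d L mv kk hL) u U μ z = fluct (((((L ^ kk : ℕ) : ℝ))⁻¹)) A μ z) ∧
          (∀ μ, ∀ z ∈ {x : ScX d L mv kk hL | blockOf (L ^ kk) (cvM d L mv kk hL) x ∈ cubeBlocks (cvM d L mv kk hL) (coverCorner (cvM d L mv kk hL) (L ^ mv) L (L * L ^ mv + 3 * L ^ mv - 1 - coverMargin L mv) k') (L * L ^ mv + 10 * L ^ mv)}, ‖A μ z‖ < C * ξ⁻¹) ∧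
          (∀ μ ν, ∀ z ∈ {x : ScX d L mv kk hL | blockOf (L ^ kk) (cvM d L mv kk hL) x ∈ cubeBlocks (cvM d L mv kk hL) (coverCorner (cvM d L mv kk hL) (L ^ mv) L (L * L ^ mv + 3 * L ^ mv - 1 - coverMargin L mv) k') (L * L ^ mv + 10 * L ^ mv)}, ‖((↑(((((L ^ kk : ℕ) : ℝ))⁻¹)) : ℂ)⁻¹) • covD (scShift d L mv kk hL) (fun _ _ => (1 : (Matrix mm mm ℂ)ˣ)) μ (A ν) z‖ < C * (ξ ^ 2)⁻¹) := fun k' => by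
    obtain ⟨A, h1, h2, h3⟩ := hdat k'
    exact ⟨w k', A, hwU k', fun μ z hz => h1 μ z (hsubB k' z hz), fun μ z hz => h2 μ z (hsubB k' z hz), fun μ ν z hz => h3 μ ν z (hsubB k' z hz)⟩
  -- the cube's datum, far zone and gauged field
  obtain ⟨A, hg, hA, hD⟩ := hdat k
  obtain ⟨Z, dZ, hdZ, hdZ0, hdZl, hmarg, hnear⟩ := exists_farZone₃ (d := d) hL hL17 mv kk hW2 k
  have hu : ∀ x, (w k x : Matrix mm mm ℂ) ∈ Matrix.unitaryGroup mm ℂ := hwU k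
  have hu' : ∀ x, ((w k x : Matrix mm mm ℂ))ᴴ * (w k x : Matrix mm mm ℂ) = 1 := fun x => Matrix.mem_unitaryGroup_iff'.mp (hu x)
  have hu1 : ∀ x, ‖(w k x : Matrix mm mm ℂ)‖ ≤ 1 ∧ ‖(((w k x)⁻¹ : (Matrix mm mm ℂ)ˣ) : Matrix mm mm ℂ)‖ ≤ 1 := fun x =>
    ⟨(CStarRing.norm_of_mem_unitary (hu x)).le, by
      rw [uN_val_inv_eq_conjTranspose (hu x)]
      exact (CStarRing.norm_of_mem_unitary (Unitary.star_mem (hu x))).le⟩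
  set V : Fin (d + 1) → ScX d L mv kk hL → (Matrix mm mm ℂ)ˣ := gaugeTr (scShift d L mv kk hL) (w k) U with hVdef
  have hVu : ∀ μ x, (V μ x : Matrix mm mm ℂ) ∈ Matrix.unitaryGroup mm ℂ := fun μ x => by
    rw [hVdef, uN_val_gaugeTr_eq (T := scShift d L mv kk hL) U (hu (scShift d L mv kk hL μ x))]
    exact Submonoid.mul_mem _ (Submonoid.mul_mem _ (hu x) (hU μ x)) (Unitary.star_mem (hu (scShift d L mv kk hL μ x)))
  have hVval : (fun μ x => (V μ x : Matrix mm mm ℂ)) = scGaugeU d L mv kk hL (fun x => (w k x : Matrix mm mm ℂ)) (fun μ x => (U μ x : Matrix mm mm ℂ)) := by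
    funext μ x
    rw [hVdef, uN_val_gaugeTr_eq (T := scShift d L mv kk hL) U (hu (scShift d L mv kk hL μ x))]
    rfl
  have hboxV : ∀ k', Reg335Cube (scShift d L mv kk hL) V (((((L ^ kk : ℕ) : ℝ))⁻¹)) {x : ScX d L mv kk hL | blockOf (L ^ kk) (cvM d L mv kk hL) x ∈ cubeBlocks (cvM d L mv kk hL) (coverCorner (cvM d L mv kk hL) (L ^ mv) L (2 * L ^ mv + 2) k') (6 * L ^ mv + 5)} ξ C :=
    fun k' => reg335Cube_gaugeTr (scShift d L mv kk hL) (fun z _ => hu1 z) (reg335Cube_box2plus_of_bigBox (d := d) hL hL11 mv kk U (ξ := ξ) (C := C) k' (hbig k'))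
  have hnearV : ∀ k', ¬ (cvSk d L mv kk hL k' ⊆ Z) → ∃ A' : Fin (d + 1) → ScX d L mv kk hL → Matrix mm mm ℂ,
      (∀ μ, ∀ z ∈ {x : ScX d L mv kk hL | blockOf (L ^ kk) (cvM d L mv kk hL) x ∈ cubeBlocks (cvM d L mv kk hL) (coverCorner (cvM d L mv kk hL) (L ^ mv) L (2 * L ^ mv + 2) k') (6 * L ^ mv + 5)}, gaugeTr (scShift d L mv kk hL) (fun _ => (1 : (Matrix mm mm ℂ)ˣ)) V μ z = fluct (((((L ^ kk : ℕ) : ℝ))⁻¹)) A' μ z) ∧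
          (∀ μ, ∀ z ∈ {x : ScX d L mv kk hL | blockOf (L ^ kk) (cvM d L mv kk hL) x ∈ cubeBlocks (cvM d L mv kk hL) (coverCorner (cvM d L mv kk hL) (L ^ mv) L (2 * L ^ mv + 2) k') (6 * L ^ mv + 5)}, ‖A' μ z‖ < C * ξ⁻¹) ∧
          (∀ μ ν, ∀ z ∈ {x : ScX d L mv kk hL | blockOf (L ^ kk) (cvM d L mv kk hL) x ∈ cubeBlocks (cvM d L mv kk hL) (coverCorner (cvM d L mv kk hL) (L ^ mv) L (2 * L ^ mv + 2) k') (6 * L ^ mv + 5)}, ‖((↑(((((L ^ kk : ℕ) : ℝ))⁻¹)) : ℂ)⁻¹) • covD (scShift d L mv kk hL) (fun _ _ => (1 : (Matrix mm mm ℂ)ˣ)) μ (A' ν) z‖ < C * (ξ ^ 2)⁻¹) := fun k' hk' =>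
    ⟨A, fun μ z hz => by rw [gaugeTr_one]; exact hg μ z (hnear k' hk' hz), fun μ z hz => hA μ z (hnear k' hk' hz), fun μ ν z hz => hD μ ν z (hnear k' hk' hz)⟩
  -- the coarse gauge: `S(V)⁻¹ = 𝕎_c S(U)⁻¹ 𝕎_cᵀ` and its row
  set Wc : Tor (cvM d L mv kk hL) → Matrix ι ι ℝ := fun y : Tor (cvM d L mv kk hL) => coordMat e (ContinuousLinearMap.mulLeftRight ℝ (Matrix mm mm ℂ) (w k (bpt (L ^ kk) (cvM d L mv kk hL) y 0) : Matrix mm mm ℂ) ((w k (bpt (L ^ kk) (cvM d L mv kk hL) y 0) : Matrix mm mm ℂ))ᴴ) with hWdef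
  have hWo : ∀ y, (Wc y)ᵀ * Wc y = 1 ∧ Wc y * (Wc y)ᵀ = 1 := fun y => uN_coordMat_conj_orthogonal e he (hu' _)
  have hW0 : ∀ x : ScX d L mv kk hL, (coordMat e (ContinuousLinearMap.mulLeftRight ℝ (Matrix mm mm ℂ) (w k x : Matrix mm mm ℂ) ((w k x : Matrix mm mm ℂ))ᴴ))ᵀ *
      coordMat e (ContinuousLinearMap.mulLeftRight ℝ (Matrix mm mm ℂ) (w k x : Matrix mm mm ℂ) ((w k x : Matrix mm mm ℂ))ᴴ) = 1 := fun x => (uN_coordMat_conj_orthogonal e he (hu' x)).1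
  set SU : Matrix (Tor (cvM d L mv kk hL) × ι) (Tor (cvM d L mv kk hL) × ι) ℝ := cSop (cvM d L mv kk hL) (L ^ kk) (cvT e (fun μ x => (U μ x : Matrix mm mm ℂ))) (aK a₀ (L : ℝ) kk * (((L ^ kk : ℕ) : ℝ)) ^ (d + 1)) with hSUdef
  have hunitU : IsUnit SU := isUnit_cSop (cvM d L mv kk hL) (L ^ kk) (isUnit_cvT ι e he (fun μ x => (U μ x : Matrix mm mm ℂ)) hU') ha'
  have hconjM : cSop (cvM d L mv kk hL) (L ^ kk) (cvT e (fun μ x => (V μ x : Matrix mm mm ℂ))) (aK a₀ (L : ℝ) kk * (((L ^ kk : ℕ) : ℝ)) ^ (d + 1)) = bdiag Wc * SU * (bdiag Wc)ᵀ := by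
    rw [hSUdef, hVval, cvT_scGaugeU ι e he hu' (fun μ x => (U μ x : Matrix mm mm ℂ))]
    exact cSop_gauge (cvM d L mv kk hL) (L ^ kk) hW0 _ _
  have hO1 : (bdiag Wc)ᵀ * bdiag Wc = 1 := bdiag_orth fun y => (hWo y).1
  have hO2 : bdiag Wc * (bdiag Wc)ᵀ = 1 := bdiag_orth' fun y => (hWo y).1
  have hinvV : (cSop (cvM d L mv kk hL) (L ^ kk) (cvT e (fun μ x => (V μ x : Matrix mm mm ℂ))) (aK a₀ (L : ℝ) kk * (((L ^ kk : ℕ) : ℝ)) ^ (d + 1)))⁻¹ = bdiag Wc * SU⁻¹ * (bdiag Wc)ᵀ := by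
    rw [hconjM]
    refine Matrix.inv_eq_right_inv ?_
    have e1 : bdiag Wc * SU * (bdiag Wc)ᵀ * (bdiag Wc * SU⁻¹ * (bdiag Wc)ᵀ) = bdiag Wc * (SU * ((bdiag Wc)ᵀ * bdiag Wc * SU⁻¹)) * (bdiag Wc)ᵀ := by
      simp only [Matrix.mul_assoc]
    rw [e1, hO1, Matrix.one_mul, Matrix.mul_nonsing_inv _ ((Matrix.isUnit_iff_isUnit_det _).mp hunitU), Matrix.mul_one, hO2]
  have hSVlin : Matrix.mulVecLin (cSop (cvM d L mv kk hL) (L ^ kk) (cvT e (fun μ x => (V μ x : Matrix mm mm ℂ))) (aK a₀ (L : ℝ) kk * (((L ^ kk : ℕ) : ℝ)) ^ (d + 1)))⁻¹ = mmulOp Wc ∘ₗ Matrix.mulVecLin SU⁻¹ ∘ₗ mmulOp (fun y => (Wc y)ᵀ) := by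
    rw [hinvV, Matrix.mulVecLin_mul, Matrix.mulVecLin_mul, mmulOp_eq_mulVecLin_bdiag, mmulOp_eq_mulVecLin_bdiag, ← bdiag_transpose, LinearMap.comp_assoc]
  have hI := HI mv kk hk hwI e he U hU ξ C hξ hC hbig rV hrV hrA hrC hRleI hσVI
  rw [← hSUdef] at hI
  have h2 := hasMaj_gaugeConj (g := (unitTorusGeo L kk (cvM d L mv kk hL))) (fun y : Tor (cvM d L mv kk hL) => y) Wc (fun y => (hWo y).2) (fun y => (hWo y).1) (fun y y' => by positivity) hI
  have hSiV : HasMaj (BlockNorm.ofBlocks (unitTorusGeo L kk (cvM d L mv kk hL)) (liftBlk (fun y : Tor (cvM d L mv kk hL) => y) ι)) (BlockNorm.ofBlocks (unitTorusGeo L kk (cvM d L mv kk hL)) (liftBlk (fun y : Tor (cvM d L mv kk hL) => y) ι)) (Matrix.mulVecLin (cSop (cvM d L mv kk hL) (L ^ kk) (cvT e (fun μ x => (V μ x : Matrix mm mm ℂ))) (aK a₀ (L : ℝ) kk * (((L ^ kk : ℕ) : ℝ)) ^ (d + 1)))⁻¹) (fun y y' => (Fintype.card ι : ℝ) ^ 2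 * BI * (((L ^ kk : ℕ) : ℝ)) ^ (d + 1) * Real.exp (-(δI * (unitTorusGeo L kk (cvM d L mv kk hL)).dist y y'))) := by
    rw [hSVlin]
    refine h2.mono fun y y' => le_of_eq ?_
    ring
  -- the raw letter at the gauged field
  have hmain := H₀ mv kk hk hw₀ e he (fun k' => cvSk d L mv kk hL k' ⊆ Z) Z dZ hdZ hdZ0 hdZl (fun k' hk' => hk') V hVu ξ C hξ hC (fun k' _ => hboxV k') hnearV rV hrV hrA hrC hRle₀ hSiV
  exact ⟨dZ, hdZ0, hdZl, hmarg, hmain⟩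

end PerCube

end Summit.QuantumFields.YangMills.BalabanUVNodes.N15.Gluing

end
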